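import Summits.CriticalPhenomena.CardyFormulaZ2.Theses.CardyBoundaryCoulombGas

/-!
# A-priori window for the Bethe roots (line `two-cluster-rate-is-stationary-gap`, crux `StripClusterRates`)

For every ordered positive solution `w : Fin M → ℝ` of the ground-state Bethe equations of the open staggered
TL(1) chain (the common hypothesis of the registered stubs `stub_betheGroundExists`, `stub_escapeIsBethe`,
`stub_relaxIsBethe`, `stub_betheKacOne`, `stub_betheKacTwo`),
`N·F(w_j) - ∑_{l ≠ j} [G(w_j - w_l) + G(w_j + w_l)] = π (j+1)`, the scattering sum is NONNEGATIVE
(`G` odd increasing and `w_j > 0` give `G(w_j - w_l) + G(w_j + w_l) ≥ 0` termwise) and `< (M-1)·π/3`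
(`|G| < π/6`), whence the counting window
`π (j+1) ≤ N·F(w_j) ≤ π (j+1) + (M-1)·π/3 ≤ (4M-1)·π/3`:
all roots of all solutions lie in the solution-independent compact window `F(w_j) ≤ (4M-1)π/(3N)` (which is
`< 2π/3 = sup F` exactly when `2M ≤ N`), and `F(w_j) ≥ π(j+1)/N`. This is the first (a-priori bound) step of
every condensation / finite-size argument for these equations and the self-map property behind the existence
proof. Mathlib only (self-contained; cf. the Bethe kernel toolkit file of the same line).
-/

noncomputable section

namespace Summit.CriticalPhenomena.CardyFormulaZ2.Cruxes.StripClusterRates.TwoClusterRateIsStationaryGap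

open scoped BigOperators

/-- One scattering term at a nonnegative root lies in `[0, π/3)`: `0 ≤ G(a - b) + G(a + b) < π/3` for `0 ≤ a`
(`G` odd and increasing with `|G| < π/6`, and `-(a+b) ≤ a - b`). [folklore] -/
theorem bk_scatteringTerm_window {a : ℝ} (ha : 0 ≤ a) (b : ℝ) :
    0 ≤ Real.arctan (Real.tanh (a - b) / Real.sqrt 3) + Real.arctan (Real.tanh (a + b) / Real.sqrt 3) ∧
      Real.arctan (Real.tanh (a - b) / Real.sqrt 3) + Real.arctan (Real.tanh (a + b) / Real.sqrt 3) <
        Real.pi / 3 := by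
  have tanh_mono : Monotone Real.tanh := fun x y hxy => by
    have key : ∀ t : ℝ, Real.tanh t = 1 - 2 / (Real.exp (2 * t) + 1) := fun t => by
      rw [Real.tanh_eq, Real.exp_neg, show Real.exp (2 * t) = Real.exp t * Real.exp t by
        rw [two_mul, Real.exp_add]]
      have ht : 0 < Real.exp t := Real.exp_pos t
      field_simp
      ring
    rw [key x, key y]
    have hx : 0 < Real.exp (2 * x) + 1 := by positivity
    have hxy' : Real.exp (2 * x) + 1 ≤ Real.exp (2 * y) + 1 := by
      linarith [Real.exp_le_exp.2 (by linarith : 2 * x ≤ 2 * y)]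
    have := div_le_div_of_nonneg_left (by norm_num : (0 : ℝ) ≤ 2) hx hxy'
    linarith
  have hG : ∀ x : ℝ, Real.arctan (Real.tanh x / Real.sqrt 3) < Real.pi / 6 := fun x => by
    rw [← Real.arctan_inv_sqrt_three, ← one_div]
    exact Real.arctan_strictMono
      (div_lt_div_of_pos_right (Real.tanh_lt_one x) (Real.sqrt_pos.2 (by norm_num : (0 : ℝ) < 3)))
  have h1 : Real.arctan (Real.tanh (-(a + b)) / Real.sqrt 3) ≤ Real.arctan (Real.tanh (a - b) / Real.sqrt 3) :=
    Real.arctan_strictMono.monotone (div_le_div_of_nonneg_right (tanh_mono (by linarith)) (Real.sqrt_nonneg 3))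
  have h2 : Real.arctan (Real.tanh (-(a + b)) / Real.sqrt 3) = -Real.arctan (Real.tanh (a + b) / Real.sqrt 3) := by
    simp only [Real.tanh_neg, neg_div, Real.arctan_neg]
  have h3 := hG (a - b)
  have h4 := hG (a + b)
  constructor <;> linarith

/-- **A-priori window for the Bethe roots** (registered helper of `stmt-CriticalPhenomena-13878`): along every
ordered positive solution of the ground-state Bethe equations with `M` roots and system size `N`,
`π(j+1) ≤ N·F(w_j) ≤ π(j+1) + (M-1)π/3` for every root. [folklore] -/
theorem bk_betheRootWindow : ∀ (N M : ℕ) (w : Fin M → ℝ), (StrictMono w ∧ (∀ j, 0 < w j) ∧ ∀ j : Fin M, (N : ℝ) * (Real.arctan ((2 + Real.sqrt 3) * Real.tanh (w j)) + Real.arctan (Real.tanh (w j))) - ∑ l ∈ Finset.univ.erase j, (Real.arctan (Real.tanh (w j - w l) / Real.sqrt 3) + Real.arctan (Real.tanh (w j + w l) / Real.sqrt 3)) = Real.pi * ((j : ℕ) + 1)) → ∀ j : Fin M, Real.pi * ((j : ℕ) + 1) ≤ (N : ℝ) * (Real.arctan ((2 + Real.sqrt 3) * Real.tanh (w j)) +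 Real.arctan (Real.tanh (w j))) ∧ (N : ℝ) * (Real.arctan ((2 + Real.sqrt 3) * Real.tanh (w j)) + Real.arctan (Real.tanh (w j))) ≤ Real.pi * ((j : ℕ) + 1) + Real.pi / 3 * ((M : ℝ) - 1) := by
  rintro N M w ⟨-, hpos, heq⟩ j
  have hj := heq j
  have hS0 : 0 ≤ ∑ l ∈ Finset.univ.erase j,
      (Real.arctan (Real.tanh (w j - w l) / Real.sqrt 3) + Real.arctan (Real.tanh (w j + w l) / Real.sqrt 3)) :=
    Finset.sum_nonneg fun l _ => (bk_scatteringTerm_window (hpos j).le (w l)).1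
  have hS1 : ∑ l ∈ Finset.univ.erase j,
      (Real.arctan (Real.tanh (w j - w l) / Real.sqrt 3) + Real.arctan (Real.tanh (w j + w l) / Real.sqrt 3)) ≤
      (Finset.univ.erase j).card • (Real.pi / 3) :=
    Finset.sum_le_card_nsmul _ _ _ fun l _ => (bk_scatteringTerm_window (hpos j).le (w l)).2.le
  have hcard : ((Finset.univ.erase j).card : ℝ) = (M : ℝ) - 1 := by
    rw [Finset.card_erase_of_mem (Finset.mem_univ j), Finset.card_univ, Fintype.card_fin,
      Nat.cast_sub (Fin.pos j), Nat.cast_one]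
  rw [nsmul_eq_mul, hcard] at hS1
  constructor <;> linarith

/-- Corollary: the solution-independent upper window `N·F(w_j) ≤ (4M-1)·π/3` for every root. [folklore] -/
theorem bk_betheRoot_upper {N M : ℕ} {w : Fin M → ℝ}
    (hw : StrictMono w ∧ (∀ j, 0 < w j) ∧ ∀ j : Fin M, (N : ℝ) *
        (Real.arctan ((2 + Real.sqrt 3) * Real.tanh (w j)) + Real.arctan (Real.tanh (w j))) -
      ∑ l ∈ Finset.univ.erase j,
        (Real.arctan (Real.tanh (w j - w l) / Real.sqrt 3) + Real.arctan (Real.tanh (w j + w l) / Real.sqrt 3)) =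
      Real.pi * ((j : ℕ) + 1)) (j : Fin M) :
    (N : ℝ) * (Real.arctan ((2 + Real.sqrt 3) * Real.tanh (w j)) + Real.arctan (Real.tanh (w j))) ≤
      (4 * (M : ℝ) - 1) * Real.pi / 3 := by
  have h := (bk_betheRootWindow N M w hw j).2
  have hjM : ((j : ℕ) : ℝ) + 1 ≤ (M : ℝ) := by exact_mod_cast (Nat.succ_le_of_lt j.is_lt)
  nlinarith [Real.pi_pos]

/-- Corollary: the lower window `π(j+1)/N ≤ F(w_j)`, in particular `π/N ≤ F(w_j)` (needs `N ≠ 0`, automatic: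
for `N = 0` the equations force `M ≤ 1`… we simply assume `0 < N`). [folklore] -/
theorem bk_betheRoot_lower {N M : ℕ} {w : Fin M → ℝ} (hN : 0 < N)
    (hw : StrictMono w ∧ (∀ j, 0 < w j) ∧ ∀ j : Fin M, (N : ℝ) *
        (Real.arctan ((2 + Real.sqrt 3) * Real.tanh (w j)) + Real.arctan (Real.tanh (w j))) -
      ∑ l ∈ Finset.univ.erase j,
        (Real.arctan (Real.tanh (w j - w l) / Real.sqrt 3) + Real.arctan (Real.tanh (w j + w l) / Real.sqrt 3)) =
      Real.pi * ((j : ℕ) + 1)) (j : Fin M) :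
    Real.pi * ((j : ℕ) + 1) / N ≤
      Real.arctan ((2 + Real.sqrt 3) * Real.tanh (w j)) + Real.arctan (Real.tanh (w j)) := by
  have h := (bk_betheRootWindow N M w hw j).1
  have hN' : (0 : ℝ) < N := by exact_mod_cast hN
  rw [div_le_iff₀ hN']
  linarith

end Summit.CriticalPhenomena.CardyFormulaZ2.Cruxes.StripClusterRates.TwoClusterRateIsStationaryGap
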